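import Summits.QuantumFields.YangMills.Theorems.BalabanUVNodesN15PerCubeGreenJetGluing
import Summits.QuantumFields.YangMills.Theorems.BalabanUVNodesN15CurvedGluingLocalGaugesClose
import HarnessLib

/-!
# N15 = NE2, road (c) — PROGRAMME (PC), towards (PC-D) «the per-cube LANDAU LETTER»: WALK LOCALITY OF A LEFT FACTOR THROUGH THE GLUED OPERATOR — two families of cube data with
# FILE 136's ∕ n15-c∕268's rows and two left factors `D`, `D♭` with the same Leibniz letters; on the cubes NOT `Far` the per-cube gauges agree and the cut rows, the `D`-cut rows,
# the commutator rows and the defects are ε-close ⟹ `D∘𝒢 − D♭∘𝒢♭ ≤ [C_near + C_far·e^{−(δ∕4−σ)d_Z(y)}]·e^{−(δ∕4−2σ)d}` (dag-n15-c g29, n15-c∕300)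

Cell `pub-ymgap`, seat `pub-ymgap-dag-n15-c` (generation g29; R134 (a), s1; HUMAN RULING D-0062).  `bears_on: R4∕N15 · K3⁸ SpineGivenEndpointR13SepCoPHV (stmt-QuantumFields-27366)`;
filed `--kind proof --supports stmt-QuantumFields-27366 --as helper` — COUNT-NEUTRAL.  Pure block-majorant algebra over LANDED theorems; 0 `def`, 0 `sorry`.  Imports n15-c∕268
`…PerCubeGreenJetGluing` (`dcutRow_of_localGauge`; through it FILE 136 `…TwoSpacingGluingGradientGluing`: `comp_glueInv`, `hasMaj_comp_parametrix`, `comp_parametrix_of_leibniz`,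
`hasMaj_sandwich_loc`, `ind_mul_ind_le`) and n15-c∕292 `…CurvedGluingLocalGaugesClose` (`cutRow∕commRow∕defectRow_sub_of_localGauge`; through it n15-c∕290∕291
`hasMaj_glueInv_sub_glueInv_farW`, `hasMaj_sum_far_out∕in`, `remainderD_eq_sum`, `hasMaj_sum_far`, `hasMaj_farW_of_outLoc`).  Nothing in the tree is modified, nothing restated.

WHY.  The per-cube Landau letter of (PC-D) (HOME `PCD-DESIGN-g28.md`) needs CLOSENESS — not only decay — of the gradient entries of [B9] (3.42): `D_VG′(V) − ∂G′(𝟙)` near a cube, with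
`V = U^{u_□}` in the class (3.35) on the cube's walk-locality box.  A row of `G′(V) − G′(𝟙)` (n15-c∕296) does NOT give it: one lattice derivative costs the factor `n = L^k` on the unit-block
norm.  The cure is the one of n15-c∕268–276 (decay of `D_UG′(U)`): carry the left factor THROUGH the gluing, so that only the dressed cubes' own jet rows are differentiated.  THIS FILE is
the abstract step: n15-c∕291 ∕ 292 (walk locality with close near data) for `D∘glueInv(…) − D♭∘glueInv(…)♭`, where `D∘𝒢 = glueInv (D∘G₀) R̃` (`comp_glueInv`) puts the whole left
factor into the parametrix slot and `D∘G₀ − D♭∘G₀♭ = Σ_□[M_{h^s_□}(D M_χG_□ − D♭M_χG♭_□)M_{h_□} + M_{dh_□}M_χ(G_□ − G♭_□)M_{h_□}]` (both factors obey the SAME Leibniz rule through the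
partition — true for `D_{V,μ}` and `∂_μ`: `h^s = h∘τ_μ`, `dh = ∇_μh` do not see the field) splits into near cubes (small: `c_sε_D + c_dε_G`) and far cubes (two-sided localized in
`S_□ ⊆ Z`, weight `e^{−(δ∕2)d_Z(y)}`); the resummation side is n15-c∕291's verbatim.

WHAT.  §1 (scalar carrier, FILE 136 level): `comp_parametrix_sub_eq_sum` (the displayed split), ★★★ `hasMaj_comp_glued_sub_of_cutRows_defect_close` (n15-c∕291's hypotheses for both
families + the Leibniz rules, the `D`-cut rows `β₁` and their near closeness `ε_D` ⟹ n15-c∕290's far-weighted majorant with `A = N_ov(c_sβ₁ + c_dβ)`, `ε₁ = N_ov(c_sε_D + c_dε_G)`,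
`a₁ = N_ov(2c_sβ₁ + 2c_dβ)`, `θ_n = N_ov(ε_K + ε_E)`, `θ₁ = 2N_ovε`, `θ₂ = 2N_ovθ₀`).  §2 (matrix carrier, per-cube gauges, FILE 46 ∕ n15-c∕268 level): `dcutRow_sub_of_localGauge`
(the `D`-cut closeness conjugates back under the two covariances `D∘M_{Wᵀ} = M_{Vᵀ}∘D♯`, `D♭∘M_{Wᵀ} = M_{Vᵀ}∘D♭♯`, factor `|κ|²`), ★★★ `hasMaj_comp_glued_sub_of_localGauges_close`
(n15-c∕268's hypotheses for two families `(W, V, Δ, D, D♯, G′, E′)`, `(W♭, V♭, Δ♭, D♭, D♭♯, G♭, E♭)`, same gauges on the cubes not `Far`, closeness in the cube's gauge ⟹ §1's majorant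
with every letter multiplied by `|κ|²`).

HONEST FRAMING ∕ LIMITS.  Algebra of glued inverses over displayed rows; no propagator estimated; [B9] (3.34)–(3.35) p.396, (3.42) p.397, Cor. 3.8 p.410, Thm 3.14 pp.426–427 and
[B6] (2.91) p.239, (2.133)–(2.136) p.247 cited for SHAPES ∕ MECHANISM, not for printed statements.  NE2⁺ NOT PRINTED, NOT proved; N15 of record untouched (DISCHARGED AS CONSUMED,
p687738); K3⁸ OPEN; counts of record UNMOVED; one finite 𝕋⁴ at fixed ε — NOT infinite volume, NOT OS on ℝ⁴, NOT a mass gap, NOT Clay.  Restate-immune (no Theses import).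
-/

set_option autoImplicit false

noncomputable section
open scoped BigOperators Matrix
open Finset

namespace Summit.QuantumFields.YangMills.BalabanUVNodes.N15.CurvedSpecies

open Literature.MathematicalPhysics.QuantumFieldTheory.Balaban1983to89
open Literature.MathematicalPhysics.QuantumFieldTheory.Balaban1983to89.B11SectG (BlockNorm HasMaj RowSum hasMaj_zero)
open Literature.MathematicalPhysics.QuantumFieldTheory.Balaban1983to89.B6RandomWalk (Triangle254)
open Literature.MathematicalPhysics.QuantumFieldTheory.Balaban1983to89.T4EtaRateCoeffDefect (diagK diagK_nonneg hasMaj_mulOp)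
open Literature.MathematicalPhysics.QuantumFieldTheory.Balaban1983to89.B6Prop26Gluing (mulOp mulOp_apply ind ind_nonneg ind_le_one ind_of_mem ind_of_not_mem)
open Summit.QuantumFields.YangMills.BalabanUVNodes.N15.MatrixSpecies (mmulOp liftBlk)
open Summit.QuantumFields.YangMills.BalabanUVNodes.N15.Gluing (parametrix remainder commOp glueInv hasMaj_parametrix hasMaj_sum_overlap hasMaj_sum_overlap_in hasMaj_comp_diag
  hasMaj_mulOp_sandwich parametrix_cut hasMaj_sum_far hasMaj_farW_of_outLoc hasMaj_glueInv_sub_glueInv_farW comp_glueInv comp_parametrix_of_leibniz hasMaj_comp_parametrix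
  hasMaj_sandwich_loc ind_mul_ind_le)

/-! ## §1 FILE 136's level: a left factor through the glued operator with defects, two families, close near data -/

section CutRows

variable {X : Type} [Fintype X] [DecidableEq X] {ι : Type} [Fintype ι] {g : B6.Geometry} (blk : X → g.Site) (S : ι → Set g.Site) (Far : ι → Prop) [DecidablePred Far]
  (Z : Set g.Site) (dZ : g.Site → ℝ) {σ cr : ℝ}

omit [Fintype X] [DecidableEq X] in
/-- the displayed split of `D∘G₀ − D♭∘G₀♭` over the cubes when both left factors obey the same Leibniz rule through the partition and the partition sits inside the cuts:
`D∘G₀ − D♭∘G₀♭ = Σ_□[M_{h^s_□}∘(D∘M_{χ_□}G_□ − D♭∘M_{χ_□}G♭_□)∘M_{h_□} + M_{dh_□}∘M_{χ_□}(G_□ − G♭_□)∘M_{h_□}]`. [cite: Balaban1984PropagatorsII, (2.136) p.247 (entries: mechanism)] -/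
theorem comp_parametrix_sub_eq_sum {D D' : (X → ℝ) →ₗ[ℝ] (X → ℝ)} {h χ hs dh : ι → X → ℝ} {G G' : ι → (X → ℝ) →ₗ[ℝ] (X → ℝ)}
    (hleib : ∀ i, D ∘ₗ mulOp (h i) = mulOp (hs i) ∘ₗ D + mulOp (dh i)) (hleib' : ∀ i, D' ∘ₗ mulOp (h i) = mulOp (hs i) ∘ₗ D' + mulOp (dh i))
    (hcut : ∀ i, mulOp (h i) ∘ₗ mulOp (χ i) = mulOp (h i)) :
    D ∘ₗ parametrix h G - D' ∘ₗ parametrix h G' =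
      ∑ i, (mulOp (hs i) ∘ₗ (D ∘ₗ (mulOp (χ i) ∘ₗ G i) - D' ∘ₗ (mulOp (χ i) ∘ₗ G' i)) ∘ₗ mulOp (h i) + mulOp (dh i) ∘ₗ (mulOp (χ i) ∘ₗ (G i - G' i)) ∘ₗ mulOp (h i)) := by
  rw [← parametrix_cut (G := G) hcut, ← parametrix_cut (G := G') hcut, comp_parametrix_of_leibniz hleib, comp_parametrix_of_leibniz hleib', ← Finset.sum_sub_distrib]
  refine Finset.sum_congr rfl fun i _ => ?_
  simp only [LinearMap.comp_sub, LinearMap.sub_comp]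
  abel

/-- ★★★ **WALK LOCALITY OF A LEFT FACTOR THROUGH FILE 32's GLUED OPERATOR WITH DEFECTS, CLOSE NEAR DATA**: n15-c∕291's two families over the SAME partition, cuts, reaches and
overlap, two left factors `D`, `D♭` with the SAME Leibniz letters (`D∘M_{h_□} = M_{h^s_□}∘D + M_{dh_□}`, `|h^s| ≤ c_s`, `|dh| ≤ c_d`), the `D`-cut rows `D∘M_χG_□, D♭∘M_χG♭_□ ≤ 1_S1_S·β₁e^{−δd}`;
on the cubes not `Far` the cut cube operators, their `D`-cut rows, the commutator pieces and the defects are `ε_G`∕`ε_D`∕`ε_K`∕`ε_E`-close, on the far cubes `S_□ ⊆ Z` ⟹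
`D∘𝒢 − D♭∘𝒢♭ ≤ [(ε₁ + AN_cθ_nc_r)N_c + (a₁ + AN_c(θ₁+θ₂)c_r)N_c·e^{−(δ∕4−σ)d_Z(y)}]·e^{−(δ∕4−2σ)d}` with `A = N_ov(c_sβ₁ + c_dβ)`, `ε₁ = N_ov(c_sε_D + c_dε_G)`, `a₁ = N_ov(2c_sβ₁ + 2c_dβ)`,
`θ_n = N_ov(ε_K + ε_E)`, `θ₁ = 2N_ovε`, `θ₂ = 2N_ovθ₀`, `N_c = (1 − N_ov(θ₀+ε)c_r)⁻¹c_r` (n15-c∕290 `hasMaj_glueInv_sub_glueInv_farW` after `comp_glueInv`).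
[cite: Balaban1985BackgroundPropagators, (3.42) p.397 (gradient entries: shape), Cor. 3.8 (3.94) p.410, Thm 3.14 pp.426–427 (mechanism); Balaban1984PropagatorsII, (2.91) p.239, (2.133)–(2.136) p.247] -/
theorem hasMaj_comp_glued_sub_of_cutRows_defect_close (htri : Triangle254 g) (hd : ∀ a b : g.Site, 0 ≤ g.dist a b) (hd0 : ∀ y : g.Site, g.dist y y = 0) (hrow : RowSum g σ cr)
    (hσ : 0 ≤ σ) (hcr : 0 ≤ cr) (hdZ : ∀ y z, z ∈ Z → dZ y ≤ g.dist y z) (hdZ0 : ∀ y, 0 ≤ dZ y)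
    {Δ Δ' D D' : (X → ℝ) →ₗ[ℝ] (X → ℝ)} {h χ hs dh : ι → X → ℝ} {G G' E E' : ι → (X → ℝ) →ₗ[ℝ] (X → ℝ)} {β β₁ cs cd θ₀ ε εG εD εK εE δ Nov : ℝ} (hβ : 0 ≤ β) (hβ₁ : 0 ≤ β₁)
    (hcs : 0 ≤ cs) (hcd : 0 ≤ cd) (hθ : 0 ≤ θ₀) (hε : 0 ≤ ε) (hεG : 0 ≤ εG) (hεD : 0 ≤ εD) (hεK : 0 ≤ εK) (hεE : 0 ≤ εE) (hNov : 0 ≤ Nov) (hσδ : 8 * σ ≤ δ)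
    (hleib : ∀ i, D ∘ₗ mulOp (h i) = mulOp (hs i) ∘ₗ D + mulOp (dh i)) (hleib' : ∀ i, D' ∘ₗ mulOp (h i) = mulOp (hs i) ∘ₗ D' + mulOp (dh i))
    (hcut : ∀ i, mulOp (h i) ∘ₗ mulOp (χ i) = mulOp (h i)) (hh : ∀ i x, |h i x| ≤ 1) (hhs : ∀ i x, |hs i x| ≤ cs) (hdh : ∀ i x, |dh i x| ≤ cd)
    (hN : ∀ a, ∑ i, ind (S i) a ≤ Nov) (hZ : ∀ i, Far i → S i ⊆ Z)
    (hGc : ∀ i, HasMaj (BlockNorm.ofBlocks g blk) (BlockNorm.ofBlocks g blk) (mulOp (χ i) ∘ₗ G i) (fun y y' => ind (S i) y * ind (S i) y' * (β * Real.exp (-(δ * g.dist y y')))))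
    (hGc' : ∀ i, HasMaj (BlockNorm.ofBlocks g blk) (BlockNorm.ofBlocks g blk) (mulOp (χ i) ∘ₗ G' i) (fun y y' => ind (S i) y * ind (S i) y' * (β * Real.exp (-(δ * g.dist y y')))))
    (hDGc : ∀ i, HasMaj (BlockNorm.ofBlocks g blk) (BlockNorm.ofBlocks g blk) (D ∘ₗ (mulOp (χ i) ∘ₗ G i)) (fun y y' => ind (S i) y * ind (S i) y' * (β₁ * Real.exp (-(δ * g.dist y y')))))
    (hDGc' : ∀ i, HasMaj (BlockNorm.ofBlocks g blk) (BlockNorm.ofBlocks g blk) (D' ∘ₗ (mulOp (χ i) ∘ₗ G' i)) (fun y y' => ind (S i) y * ind (S i) y' * (β₁ * Real.exp (-(δ * g.dist y y')))))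
    (hK : ∀ i, HasMaj (BlockNorm.ofBlocks g blk) (BlockNorm.ofBlocks g blk) (commOp Δ (h i) ∘ₗ G i) (fun y y' => ind (S i) y' * (θ₀ * Real.exp (-(δ * g.dist y y')))))
    (hK' : ∀ i, HasMaj (BlockNorm.ofBlocks g blk) (BlockNorm.ofBlocks g blk) (commOp Δ' (h i) ∘ₗ G' i) (fun y y' => ind (S i) y' * (θ₀ * Real.exp (-(δ * g.dist y y')))))
    (hE : ∀ i, HasMaj (BlockNorm.ofBlocks g blk) (BlockNorm.ofBlocks g blk) (E i) (fun y y' => ind (S i) y * (ε * Real.exp (-(δ * g.dist y y')))))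
    (hE' : ∀ i, HasMaj (BlockNorm.ofBlocks g blk) (BlockNorm.ofBlocks g blk) (E' i) (fun y y' => ind (S i) y * (ε * Real.exp (-(δ * g.dist y y')))))
    (hGG : ∀ i, ¬Far i → HasMaj (BlockNorm.ofBlocks g blk) (BlockNorm.ofBlocks g blk) (mulOp (χ i) ∘ₗ (G i - G' i))
      (fun y y' => ind (S i) y * ind (S i) y' * (εG * Real.exp (-(δ * g.dist y y')))))
    (hDGG : ∀ i, ¬Far i → HasMaj (BlockNorm.ofBlocks g blk) (BlockNorm.ofBlocks g blk) (D ∘ₗ (mulOp (χ i) ∘ₗ G i) - D' ∘ₗ (mulOp (χ i) ∘ₗ G' i))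
      (fun y y' => ind (S i) y * ind (S i) y' * (εD * Real.exp (-(δ * g.dist y y')))))
    (hKK : ∀ i, ¬Far i → HasMaj (BlockNorm.ofBlocks g blk) (BlockNorm.ofBlocks g blk) (commOp Δ (h i) ∘ₗ G i - commOp Δ' (h i) ∘ₗ G' i)
      (fun y y' => ind (S i) y' * (εK * Real.exp (-(δ * g.dist y y')))))
    (hEE : ∀ i, ¬Far i → HasMaj (BlockNorm.ofBlocks g blk) (BlockNorm.ofBlocks g blk) (E i - E' i) (fun y y' => ind (S i) y * (εE * Real.exp (-(δ * g.dist y y')))))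
    (hq : Nov * (θ₀ + ε) * cr < 1) :
    HasMaj (BlockNorm.ofBlocks g blk) (BlockNorm.ofBlocks g blk)
      (D ∘ₗ glueInv (parametrix h G) (remainder Δ h G - ∑ i, E i ∘ₗ mulOp (h i)) - D' ∘ₗ glueInv (parametrix h G') (remainder Δ' h G' - ∑ i, E' i ∘ₗ mulOp (h i)))
      (fun y y' => ((Nov * (cs * εD + cd * εG) + Nov * (cs * β₁ + cd * β) * ((1 - Nov * (θ₀ + ε) * cr)⁻¹ * cr) * (Nov * (εK + εE)) * cr) * ((1 - Nov * (θ₀ + ε) * cr)⁻¹ * cr) +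
          (Nov * (cs * (2 * β₁) + cd * (2 * β)) + Nov * (cs * β₁ + cd * β) * ((1 - Nov * (θ₀ + ε) * cr)⁻¹ * cr) * (Nov * (2 * ε) + Nov * (2 * θ₀)) * cr) *
            ((1 - Nov * (θ₀ + ε) * cr)⁻¹ * cr) * Real.exp (-((δ / 4 - σ) * dZ y))) * Real.exp (-((δ / 4 - 2 * σ) * g.dist y y'))) := by
  classical
  have hnn1 : ∀ {c : ℝ}, 0 ≤ c → ∀ (i : ι) (y y' : g.Site), 0 ≤ ind (S i) y * (c * Real.exp (-(δ * g.dist y y'))) := fun hc i y y' =>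
    mul_nonneg (ind_nonneg _ _) (mul_nonneg hc (Real.exp_nonneg _))
  have hnn1i : ∀ {c : ℝ}, 0 ≤ c → ∀ (i : ι) (y y' : g.Site), 0 ≤ ind (S i) y' * (c * Real.exp (-(δ * g.dist y y'))) := fun hc i y y' =>
    mul_nonneg (ind_nonneg _ _) (mul_nonneg hc (Real.exp_nonneg _))
  have hnn2 : ∀ {c : ℝ}, 0 ≤ c → ∀ (i : ι) (y y' : g.Site), 0 ≤ ind (S i) y * ind (S i) y' * (c * Real.exp (-(δ * g.dist y y'))) := fun hc i y y' =>
    mul_nonneg (mul_nonneg (ind_nonneg _ _) (ind_nonneg _ _)) (mul_nonneg hc (Real.exp_nonneg _))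
  have h2β : 0 ≤ 2 * β := by positivity
  have h2β₁ : 0 ≤ 2 * β₁ := by positivity
  -- the per-cube pieces of `D∘G₀ − D♭∘G₀♭` and their near ∕ far families
  set T : ι → (X → ℝ) →ₗ[ℝ] (X → ℝ) := fun i =>
    mulOp (hs i) ∘ₗ (D ∘ₗ (mulOp (χ i) ∘ₗ G i) - D' ∘ₗ (mulOp (χ i) ∘ₗ G' i)) ∘ₗ mulOp (h i) + mulOp (dh i) ∘ₗ (mulOp (χ i) ∘ₗ (G i - G' i)) ∘ₗ mulOp (h i) with hT
  set Dn : ι → (X → ℝ) →ₗ[ℝ] (X → ℝ) := fun i => if Far i then 0 else T i with hDn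
  set Df : ι → (X → ℝ) →ₗ[ℝ] (X → ℝ) := fun i => if Far i then T i else 0 with hDf
  set KnK : ι → (X → ℝ) →ₗ[ℝ] (X → ℝ) := fun i => if Far i then 0 else -((commOp Δ (h i) ∘ₗ G i - commOp Δ' (h i) ∘ₗ G' i) ∘ₗ mulOp (h i)) with hKnK
  set KnE : ι → (X → ℝ) →ₗ[ℝ] (X → ℝ) := fun i => if Far i then 0 else -((E i - E' i) ∘ₗ mulOp (h i)) with hKnE
  set Ko : ι → (X → ℝ) →ₗ[ℝ] (X → ℝ) := fun i => if Far i then -((E i - E' i) ∘ₗ mulOp (h i)) else 0 with hKo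
  set Ki : ι → (X → ℝ) →ₗ[ℝ] (X → ℝ) := fun i => if Far i then -((commOp Δ (h i) ∘ₗ G i - commOp Δ' (h i) ∘ₗ G' i) ∘ₗ mulOp (h i)) else 0 with hKi
  -- the two splits
  have hsplitP : D ∘ₗ parametrix h G - D' ∘ₗ parametrix h G' = ∑ i, Dn i + ∑ i, Df i := by
    rw [comp_parametrix_sub_eq_sum hleib hleib' hcut, ← Finset.sum_add_distrib]
    refine Finset.sum_congr rfl fun i _ => ?_
    simp only [hDn, hDf, hT]
    split_ifs <;> simp
  have hsplitR : (remainder Δ h G - ∑ i, E i ∘ₗ mulOp (h i)) - (remainder Δ' h G' - ∑ i, E' i ∘ₗ mulOp (h i)) =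
      (∑ i, KnK i + ∑ i, KnE i) + (∑ i, Ko i + ∑ i, Ki i) := by
    rw [remainderD_eq_sum, remainderD_eq_sum, ← Finset.sum_sub_distrib, ← Finset.sum_add_distrib, ← Finset.sum_add_distrib, ← Finset.sum_add_distrib]
    refine Finset.sum_congr rfl fun i _ => ?_
    simp only [hKnK, hKnE, hKo, hKi]
    split_ifs
    · simp only [zero_add, LinearMap.sub_comp, LinearMap.add_comp]; abel
    · simp only [add_zero, LinearMap.sub_comp, LinearMap.add_comp]; abel
  -- rows of the primed pair: the left-dressed parametrix (FILE 136's `hasMaj_comp_parametrix`) and both remainders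
  have hP' : HasMaj (BlockNorm.ofBlocks g blk) (BlockNorm.ofBlocks g blk) (D' ∘ₗ parametrix h G') (fun y y' => Nov * (cs * β₁ + cd * β) * Real.exp (-(δ * g.dist y y'))) := by
    have hP := hasMaj_comp_parametrix blk S hβ hβ₁ hcs hcd hleib' hh hhs hdh hN hGc' hDGc'
    rw [parametrix_cut hcut] at hP
    exact hP
  have hR := hasMaj_remainderD blk S hθ hε hh hN hK hE
  have hR' := hasMaj_remainderD blk S hθ hε hh hN hK' hE'
  have hMb : ∀ i, HasMaj (BlockNorm.ofBlocks g blk) (BlockNorm.ofBlocks g blk) (mulOp (h i)) (diagK fun _ => (1 : ℝ)) := fun i =>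
    hasMaj_mulOp (g := g) blk (m := fun _ => (1 : ℝ)) (fun _ => zero_le_one) (hh i)
  -- near parts: plain small rows (the two sandwiches of the near cube pieces, bounded overlap)
  have hDn' : HasMaj (BlockNorm.ofBlocks g blk) (BlockNorm.ofBlocks g blk) (∑ i, Dn i) (fun y y' => Nov * (cs * εD + cd * εG) * Real.exp (-(δ * g.dist y y'))) := by
    refine (hasMaj_sum_overlap (b₁ := BlockNorm.ofBlocks g blk) (b₃ := BlockNorm.ofBlocks g blk) _ S (fun y y' => (cs * εD + cd * εG) * Real.exp (-(δ * g.dist y y'))) Nov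
      (fun y y' => mul_nonneg (by positivity) (Real.exp_nonneg _)) (fun i => ?_) hN).mono fun y y' => le_of_eq (by ring)
    by_cases hi : Far i
    · simp only [hDn, if_pos hi]; exact (hasMaj_zero _ _).mono (hnn1 (by positivity) i)
    · simp only [hDn, if_neg hi, hT]
      have t1 := hasMaj_sandwich_loc blk hcs zero_le_one hεD (hhs i) (hh i) (hDGG i hi)
      have t2 := hasMaj_sandwich_loc blk hcd zero_le_one hεG (hdh i) (hh i) (hGG i hi)
      refine (t1.add t2).mono fun y y' => ?_
      have key := ind_mul_ind_le (Sc := S i) (A := (cs * εD + cd * εG) * Real.exp (-(δ * g.dist y y'))) (mul_nonneg (by positivity) (Real.exp_nonneg _)) y y'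
      calc ind (S i) y * ind (S i) y' * (cs * εD * 1 * Real.exp (-(δ * g.dist y y'))) + ind (S i) y * ind (S i) y' * (cd * εG * 1 * Real.exp (-(δ * g.dist y y')))
          = ind (S i) y * ind (S i) y' * ((cs * εD + cd * εG) * Real.exp (-(δ * g.dist y y'))) := by ring
        _ ≤ _ := key
  have hEnK : HasMaj (BlockNorm.ofBlocks g blk) (BlockNorm.ofBlocks g blk) (∑ i, KnK i) (fun y y' => Nov * (εK * Real.exp (-(δ * g.dist y y')))) := by
    refine hasMaj_sum_overlap_in (b₁ := BlockNorm.ofBlocks g blk) (b₃ := BlockNorm.ofBlocks g blk) _ S _ Nov (fun y y' => mul_nonneg hεK (Real.exp_nonneg _)) (fun i => ?_) hN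
    by_cases hi : Far i
    · simp only [hKnK, if_pos hi]; exact (hasMaj_zero _ _).mono (hnn1i hεK i)
    · simp only [hKnK, if_neg hi]; exact ((hasMaj_comp_diag blk (hnn1i hεK i) (hKK i hi) (hMb i)).neg).mono fun y y' => le_of_eq (by ring)
  have hEnE : HasMaj (BlockNorm.ofBlocks g blk) (BlockNorm.ofBlocks g blk) (∑ i, KnE i) (fun y y' => Nov * (εE * Real.exp (-(δ * g.dist y y')))) := by
    refine hasMaj_sum_overlap (b₁ := BlockNorm.ofBlocks g blk) (b₃ := BlockNorm.ofBlocks g blk) _ S _ Nov (fun y y' => mul_nonneg hεE (Real.exp_nonneg _)) (fun i => ?_) hN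
    by_cases hi : Far i
    · simp only [hKnE, if_pos hi]; exact (hasMaj_zero _ _).mono (hnn1 hεE i)
    · simp only [hKnE, if_neg hi]; exact ((hasMaj_comp_diag blk (hnn1 hεE i) (hEE i hi) (hMb i)).neg).mono fun y y' => le_of_eq (by ring)
  have hEn : HasMaj (BlockNorm.ofBlocks g blk) (BlockNorm.ofBlocks g blk) (∑ i, KnK i + ∑ i, KnE i) (fun y y' => Nov * (εK + εE) * Real.exp (-(δ * g.dist y y'))) :=
    (hEnK.add hEnE).mono fun y y' => le_of_eq (by ring)
  -- far parts: the parametrix pieces two-sided (hence output-localized, hence far-weighted), the defects output-localized, the commutators input-localized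
  have hDf0 : HasMaj (BlockNorm.ofBlocks g blk) (BlockNorm.ofBlocks g blk) (∑ i, Df i) (fun y y' => ind Z y * (Nov * (cs * (2 * β₁) + cd * (2 * β)) * Real.exp (-(δ * g.dist y y')))) := by
    refine hasMaj_sum_far blk S Far Z hN hZ (c := cs * (2 * β₁) + cd * (2 * β)) (δ := δ) (by positivity) (fun i => ?_) (fun i hi => by simp only [hDf, if_neg hi])
    by_cases hi : Far i
    · simp only [hDf, if_pos hi, hT]
      have hGGf : HasMaj (BlockNorm.ofBlocks g blk) (BlockNorm.ofBlocks g blk) (mulOp (χ i) ∘ₗ (G i - G' i))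
          (fun y y' => ind (S i) y * ind (S i) y' * (2 * β * Real.exp (-(δ * g.dist y y')))) := by
        rw [LinearMap.comp_sub]; exact ((hGc i).sub (hGc' i)).mono fun y y' => le_of_eq (by ring)
      have t1 := hasMaj_sandwich_loc blk hcs zero_le_one h2β₁ (hhs i) (hh i) (((hDGc i).sub (hDGc' i)).mono fun y y' => le_of_eq (by ring))
      have t2 := hasMaj_sandwich_loc blk hcd zero_le_one h2β (hdh i) (hh i) hGGf
      exact (t1.add t2).mono fun y y' => le_of_eq (by ring)
    · simp only [hDf, if_neg hi]; exact (hasMaj_zero _ _).mono (hnn2 (by positivity) i)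
  have hDf' : HasMaj (BlockNorm.ofBlocks g blk) (BlockNorm.ofBlocks g blk) (∑ i, Df i)
      (fun y y' => Real.exp (-(δ / 2 * dZ y)) * (Nov * (cs * (2 * β₁) + cd * (2 * β)) * Real.exp (-(δ / 2 * g.dist y y')))) :=
    (hasMaj_farW_of_outLoc Z dZ hd0 hdZ (by positivity) (by linarith : (0 : ℝ) ≤ δ / 2) hDf0).mono fun y y' =>
      mul_le_mul_of_nonneg_left (mul_le_mul_of_nonneg_left (Real.exp_le_exp.mpr (by nlinarith [hd y y'])) (by positivity)) (Real.exp_nonneg _)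
  have hEo : HasMaj (BlockNorm.ofBlocks g blk) (BlockNorm.ofBlocks g blk) (∑ i, Ko i) (fun y y' => ind Z y * (Nov * (2 * ε) * Real.exp (-(δ * g.dist y y')))) := by
    refine hasMaj_sum_far_out blk S Far Z hN hZ (by positivity) (fun i hi => ?_) (fun i hi => by simp only [hKo, if_neg hi])
    simp only [hKo, if_pos hi]
    exact ((hasMaj_comp_diag blk (hnn1 (c := 2 * ε) (by positivity) i) (((hE i).sub (hE' i)).mono fun y y' => le_of_eq (by ring)) (hMb i)).neg).mono fun y y' => le_of_eq (by ring)
  have hEi : HasMaj (BlockNorm.ofBlocks g blk) (BlockNorm.ofBlocks g blk) (∑ i, Ki i) (fun y y' => ind Z y' * (Nov * (2 * θ₀) * Real.exp (-(δ * g.dist y y')))) := by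
    refine hasMaj_sum_far_in blk S Far Z hN hZ (by positivity) (fun i hi => ?_) (fun i hi => by simp only [hKi, if_neg hi])
    simp only [hKi, if_pos hi]
    exact ((hasMaj_comp_diag blk (hnn1i (c := 2 * θ₀) (by positivity) i) (((hK i).sub (hK' i)).mono fun y y' => le_of_eq (by ring)) (hMb i)).neg).mono fun y y' => le_of_eq (by ring)
  rw [comp_glueInv, comp_glueInv]
  exact hasMaj_glueInv_sub_glueInv_farW blk Z dZ htri hd hd0 hrow hσ hcr hdZ hdZ0 (by positivity) (mul_nonneg hNov (add_nonneg hθ hε)) (by positivity) (by positivity)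
    (by positivity) (by positivity) (by positivity) hσδ hsplitP hsplitR hP' hR hR' hDn' hEn hDf' hEo hEi hq

end CutRows

/-! ## §2 FILE 46 ∕ n15-c∕268's level: per-cube gauges, the left factors' covariances displayed, close near data in the cube's gauge -/

section LocalGauges

variable {X : Type} [Fintype X] [DecidableEq X] {κ : Type} [Fintype κ] [DecidableEq κ] {K : Type} [Fintype K] {g : B6.Geometry} (blk : X → g.Site) (S : K → Set g.Site)
  (W V : K → X → Matrix κ κ ℝ) (Δ D : (X × κ → ℝ) →ₗ[ℝ] (X × κ → ℝ)) (Dl : K → (X × κ → ℝ) →ₗ[ℝ] (X × κ → ℝ)) (hX χX hsX dhX : K → X → ℝ)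
  (G' E' : K → (X × κ → ℝ) →ₗ[ℝ] (X × κ → ℝ))
  (W₂ V₂ : K → X → Matrix κ κ ℝ) (Δ₂ D₂ : (X × κ → ℝ) →ₗ[ℝ] (X × κ → ℝ)) (Dl₂ : K → (X × κ → ℝ) →ₗ[ℝ] (X × κ → ℝ)) (G₂' E₂' : K → (X × κ → ℝ) →ₗ[ℝ] (X × κ → ℝ))
  (Far : K → Prop) [DecidablePred Far] (Z : Set g.Site) (dZ : g.Site → ℝ) {σ cr : ℝ}

omit [DecidableEq X] [Fintype K] in
/-- ★ **`D`-CUT CLOSENESS TRANSFERS** (one gauge `W`, one covariance family `V`, two left factors): `D♯∘M_χG′ − D♭♯∘M_χG♭ ≤ 1_S1_S·εe^{−δd}` in the cube's gauge,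
`D∘M_{Wᵀ} = M_{Vᵀ}∘D♯`, `D♭∘M_{Wᵀ} = M_{Vᵀ}∘D♭♯`, `WWᵀ = 1`, `VᵀV = 1` ⟹ `D∘M_χ(M_{Wᵀ}G′M_W) − D♭∘M_χ(M_{Wᵀ}G♭M_W) ≤ 1_S1_S·|κ|²ε·e^{−δd}`.
[cite: Balaban1985BackgroundPropagators, (3.34)–(3.35) p.396, (3.42) p.397 (gradient entries: shape)] -/
theorem dcutRow_sub_of_localGauge (hW : ∀ k x, W k x * (W k x)ᵀ = 1) (hV' : ∀ k x, (V k x)ᵀ * V k x = 1) {ε δ : ℝ} (hε : 0 ≤ ε) (k : K)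
    (hDcov : D ∘ₗ mmulOp (fun x => (W k x)ᵀ) = mmulOp (fun x => (V k x)ᵀ) ∘ₗ Dl k) (hDcov₂ : D₂ ∘ₗ mmulOp (fun x => (W k x)ᵀ) = mmulOp (fun x => (V k x)ᵀ) ∘ₗ Dl₂ k)
    (h : HasMaj (BlockNorm.ofBlocks g (liftBlk blk κ)) (BlockNorm.ofBlocks g (liftBlk blk κ))
      (Dl k ∘ₗ (mulOp (fun p : X × κ => χX k p.1) ∘ₗ G' k) - Dl₂ k ∘ₗ (mulOp (fun p : X × κ => χX k p.1) ∘ₗ G₂' k))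
      (fun y y' => ind (S k) y * ind (S k) y' * (ε * Real.exp (-(δ * g.dist y y'))))) :
    HasMaj (BlockNorm.ofBlocks g (liftBlk blk κ)) (BlockNorm.ofBlocks g (liftBlk blk κ))
      (D ∘ₗ (mulOp (fun p : X × κ => χX k p.1) ∘ₗ (mmulOp (fun x => (W k x)ᵀ) ∘ₗ G' k ∘ₗ mmulOp (W k))) -
        D₂ ∘ₗ (mulOp (fun p : X × κ => χX k p.1) ∘ₗ (mmulOp (fun x => (W k x)ᵀ) ∘ₗ G₂' k ∘ₗ mmulOp (W k))))
      (fun y y' => ind (S k) y * ind (S k) y' * ((Fintype.card κ : ℝ) ^ 2 * ε * Real.exp (-(δ * g.dist y y')))) := by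
  have e1 := mulOp_comp_gaugeConj (fun x => (W k x)ᵀ) (χX k) (G' k)
  have e2 := mulOp_comp_gaugeConj (fun x => (W k x)ᵀ) (χX k) (G₂' k)
  simp only [Matrix.transpose_transpose] at e1 e2
  rw [show (fun x => W k x) = W k from rfl] at e1 e2
  rw [e1, e2, show D ∘ₗ (mmulOp (fun x => (W k x)ᵀ) ∘ₗ (mulOp (fun p : X × κ => χX k p.1) ∘ₗ G' k) ∘ₗ mmulOp (W k)) =
      mmulOp (fun x => (V k x)ᵀ) ∘ₗ (Dl k ∘ₗ (mulOp (fun p : X × κ => χX k p.1) ∘ₗ G' k)) ∘ₗ mmulOp (W k) by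
    rw [← LinearMap.comp_assoc, ← LinearMap.comp_assoc, hDcov]; simp only [LinearMap.comp_assoc],
    show D₂ ∘ₗ (mmulOp (fun x => (W k x)ᵀ) ∘ₗ (mulOp (fun p : X × κ => χX k p.1) ∘ₗ G₂' k) ∘ₗ mmulOp (W k)) =
      mmulOp (fun x => (V k x)ᵀ) ∘ₗ (Dl₂ k ∘ₗ (mulOp (fun p : X × κ => χX k p.1) ∘ₗ G₂' k)) ∘ₗ mmulOp (W k) by
    rw [← LinearMap.comp_assoc, ← LinearMap.comp_assoc, hDcov₂]; simp only [LinearMap.comp_assoc],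
    ← LinearMap.comp_sub, ← LinearMap.sub_comp]
  refine (hasMaj_sandwich_of_entry_le_one blk (fun y y' => ?_) (transpose_entry_le_one_of_orthogonal (hV' k)) (entry_le_one_of_orthogonal (hW k)) h).mono
    fun y y' => le_of_eq (by ring)
  exact mul_nonneg (mul_nonneg (ind_nonneg _ y) (ind_nonneg _ y')) (mul_nonneg hε (Real.exp_nonneg _))

/-- ★★★ **WALK LOCALITY OF A LEFT FACTOR THROUGH THE GLUED OPERATOR FROM PER-CUBE-GAUGE PARAMETRICES, CLOSE NEAR DATA** — n15-c∕268 `hasMaj_comp_glued_of_localGauges`' hypotheses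
for two data sets `(W, V, Δ, D, D♯, G′, E′)`, `(W♭, V♭, Δ♭, D♭, D♭♯, G♭, E♭)` over the same partition, cuts, Leibniz letters, reaches, overlap and smallness; on the cubes not `Far` the
gauges AND the covariance families AGREE and the data are ε-close in the cube's gauge (cut rows `ε_G`, `D♯`-cut rows `ε_D`, commutator rows `ε_K`, defects `ε_E`); `S_□ ⊆ Z` on the far
cubes; `8σ ≤ δ` ⟹ `D∘𝒢 − D♭∘𝒢♭ ≤` §1's majorant with every letter multiplied by `|κ|²`.
[cite: Balaban1985BackgroundPropagators, (3.34)–(3.35) p.396, (3.42) p.397 (gradient entries: shape), Cor. 3.8 p.410, Thm 3.14 pp.426–427 (mechanism); Balaban1984PropagatorsII, (2.91) p.239, (2.133)–(2.136) p.247] -/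
theorem hasMaj_comp_glued_sub_of_localGauges_close (htri : Triangle254 g) (hd : ∀ a b : g.Site, 0 ≤ g.dist a b) (hd0 : ∀ y : g.Site, g.dist y y = 0) (hrow : RowSum g σ cr)
    (hσ : 0 ≤ σ) (hcr : 0 ≤ cr) (hdZ : ∀ y z, z ∈ Z → dZ y ≤ g.dist y z) (hdZ0 : ∀ y, 0 ≤ dZ y)
    (hW : ∀ k x, W k x * (W k x)ᵀ = 1) (hW' : ∀ k x, (W k x)ᵀ * W k x = 1) (hV' : ∀ k x, (V k x)ᵀ * V k x = 1)
    (hW₂ : ∀ k x, W₂ k x * (W₂ k x)ᵀ = 1) (hW₂' : ∀ k x, (W₂ k x)ᵀ * W₂ k x = 1) (hV₂' : ∀ k x, (V₂ k x)ᵀ * V₂ k x = 1)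
    {β β₁ cs cd θ₀ ε εG εD εK εE δ Nov : ℝ} (hβ : 0 ≤ β) (hβ₁ : 0 ≤ β₁) (hcs : 0 ≤ cs) (hcd : 0 ≤ cd) (hθ : 0 ≤ θ₀) (hε : 0 ≤ ε) (hεG : 0 ≤ εG) (hεD : 0 ≤ εD) (hεK : 0 ≤ εK)
    (hεE : 0 ≤ εE) (hNov : 0 ≤ Nov) (hσδ : 8 * σ ≤ δ)
    (hDcov : ∀ k, D ∘ₗ mmulOp (fun x => (W k x)ᵀ) = mmulOp (fun x => (V k x)ᵀ) ∘ₗ Dl k)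
    (hDcov₂ : ∀ k, D₂ ∘ₗ mmulOp (fun x => (W₂ k x)ᵀ) = mmulOp (fun x => (V₂ k x)ᵀ) ∘ₗ Dl₂ k)
    (hleib : ∀ k, D ∘ₗ mulOp (fun p : X × κ => hX k p.1) = mulOp (fun p : X × κ => hsX k p.1) ∘ₗ D + mulOp (fun p : X × κ => dhX k p.1))
    (hleib₂ : ∀ k, D₂ ∘ₗ mulOp (fun p : X × κ => hX k p.1) = mulOp (fun p : X × κ => hsX k p.1) ∘ₗ D₂ + mulOp (fun p : X × κ => dhX k p.1))
    (hcut : ∀ k, mulOp (fun p : X × κ => hX k p.1) ∘ₗ mulOp (fun p : X × κ => χX k p.1) = mulOp (fun p : X × κ => hX k p.1)) (hh : ∀ k p, |(fun p : X × κ => hX k p.1) p| ≤ 1)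
    (hhs : ∀ k p, |(fun p : X × κ => hsX k p.1) p| ≤ cs) (hdh : ∀ k p, |(fun p : X × κ => dhX k p.1) p| ≤ cd)
    (hN : ∀ a, ∑ k, ind (S k) a ≤ Nov) (hZ : ∀ k, Far k → S k ⊆ Z) (hWW : ∀ k, ¬Far k → W₂ k = W k) (hVV : ∀ k, ¬Far k → V₂ k = V k)
    (hGc' : ∀ k, HasMaj (BlockNorm.ofBlocks g (liftBlk blk κ)) (BlockNorm.ofBlocks g (liftBlk blk κ)) (mulOp (fun p : X × κ => χX k p.1) ∘ₗ G' k)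
      (fun y y' => ind (S k) y * ind (S k) y' * (β * Real.exp (-(δ * g.dist y y')))))
    (hGc₂' : ∀ k, HasMaj (BlockNorm.ofBlocks g (liftBlk blk κ)) (BlockNorm.ofBlocks g (liftBlk blk κ)) (mulOp (fun p : X × κ => χX k p.1) ∘ₗ G₂' k)
      (fun y y' => ind (S k) y * ind (S k) y' * (β * Real.exp (-(δ * g.dist y y')))))
    (hDGc' : ∀ k, HasMaj (BlockNorm.ofBlocks g (liftBlk blk κ)) (BlockNorm.ofBlocks g (liftBlk blk κ)) (Dl k ∘ₗ (mulOp (fun p : X × κ => χX k p.1) ∘ₗ G' k))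
      (fun y y' => ind (S k) y * ind (S k) y' * (β₁ * Real.exp (-(δ * g.dist y y')))))
    (hDGc₂' : ∀ k, HasMaj (BlockNorm.ofBlocks g (liftBlk blk κ)) (BlockNorm.ofBlocks g (liftBlk blk κ)) (Dl₂ k ∘ₗ (mulOp (fun p : X × κ => χX k p.1) ∘ₗ G₂' k))
      (fun y y' => ind (S k) y * ind (S k) y' * (β₁ * Real.exp (-(δ * g.dist y y')))))
    (hK' : ∀ k, HasMaj (BlockNorm.ofBlocks g (liftBlk blk κ)) (BlockNorm.ofBlocks g (liftBlk blk κ))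
      (commOp (mmulOp (W k) ∘ₗ Δ ∘ₗ mmulOp (fun x => (W k x)ᵀ)) (fun p : X × κ => hX k p.1) ∘ₗ G' k) (fun y y' => ind (S k) y' * (θ₀ * Real.exp (-(δ * g.dist y y')))))
    (hK₂' : ∀ k, HasMaj (BlockNorm.ofBlocks g (liftBlk blk κ)) (BlockNorm.ofBlocks g (liftBlk blk κ))
      (commOp (mmulOp (W₂ k) ∘ₗ Δ₂ ∘ₗ mmulOp (fun x => (W₂ k x)ᵀ)) (fun p : X × κ => hX k p.1) ∘ₗ G₂' k) (fun y y' => ind (S k) y' * (θ₀ * Real.exp (-(δ * g.dist y y')))))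
    (hE' : ∀ k, HasMaj (BlockNorm.ofBlocks g (liftBlk blk κ)) (BlockNorm.ofBlocks g (liftBlk blk κ)) (E' k) (fun y y' => ind (S k) y * (ε * Real.exp (-(δ * g.dist y y')))))
    (hE₂' : ∀ k, HasMaj (BlockNorm.ofBlocks g (liftBlk blk κ)) (BlockNorm.ofBlocks g (liftBlk blk κ)) (E₂' k) (fun y y' => ind (S k) y * (ε * Real.exp (-(δ * g.dist y y')))))
    (hGG : ∀ k, ¬Far k → HasMaj (BlockNorm.ofBlocks g (liftBlk blk κ)) (BlockNorm.ofBlocks g (liftBlk blk κ)) (mulOp (fun p : X × κ => χX k p.1) ∘ₗ (G' k - G₂' k))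
      (fun y y' => ind (S k) y * ind (S k) y' * (εG * Real.exp (-(δ * g.dist y y')))))
    (hDGG : ∀ k, ¬Far k → HasMaj (BlockNorm.ofBlocks g (liftBlk blk κ)) (BlockNorm.ofBlocks g (liftBlk blk κ))
      (Dl k ∘ₗ (mulOp (fun p : X × κ => χX k p.1) ∘ₗ G' k) - Dl₂ k ∘ₗ (mulOp (fun p : X × κ => χX k p.1) ∘ₗ G₂' k))
      (fun y y' => ind (S k) y * ind (S k) y' * (εD * Real.exp (-(δ * g.dist y y')))))
    (hKK : ∀ k, ¬Far k → HasMaj (BlockNorm.ofBlocks g (liftBlk blk κ)) (BlockNorm.ofBlocks g (liftBlk blk κ))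
      (commOp (mmulOp (W k) ∘ₗ Δ ∘ₗ mmulOp (fun x => (W k x)ᵀ)) (fun p : X × κ => hX k p.1) ∘ₗ G' k -
        commOp (mmulOp (W k) ∘ₗ Δ₂ ∘ₗ mmulOp (fun x => (W k x)ᵀ)) (fun p : X × κ => hX k p.1) ∘ₗ G₂' k) (fun y y' => ind (S k) y' * (εK * Real.exp (-(δ * g.dist y y')))))
    (hEE : ∀ k, ¬Far k → HasMaj (BlockNorm.ofBlocks g (liftBlk blk κ)) (BlockNorm.ofBlocks g (liftBlk blk κ)) (E' k - E₂' k) (fun y y' => ind (S k) y * (εE * Real.exp (-(δ * g.dist y y')))))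
    (hq : Nov * ((Fintype.card κ : ℝ) ^ 2 * θ₀ + (Fintype.card κ : ℝ) ^ 2 * ε) * cr < 1) :
    HasMaj (BlockNorm.ofBlocks g (liftBlk blk κ)) (BlockNorm.ofBlocks g (liftBlk blk κ))
      (D ∘ₗ glueInv (parametrix (fun k => fun p : X × κ => hX k p.1) (fun k => mmulOp (fun x => (W k x)ᵀ) ∘ₗ G' k ∘ₗ mmulOp (W k)))
          (remainder Δ (fun k => fun p : X × κ => hX k p.1) (fun k => mmulOp (fun x => (W k x)ᵀ) ∘ₗ G' k ∘ₗ mmulOp (W k)) -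
            ∑ k, (mmulOp (fun x => (W k x)ᵀ) ∘ₗ E' k ∘ₗ mmulOp (W k)) ∘ₗ mulOp (fun p : X × κ => hX k p.1)) -
        D₂ ∘ₗ glueInv (parametrix (fun k => fun p : X × κ => hX k p.1) (fun k => mmulOp (fun x => (W₂ k x)ᵀ) ∘ₗ G₂' k ∘ₗ mmulOp (W₂ k)))
          (remainder Δ₂ (fun k => fun p : X × κ => hX k p.1) (fun k => mmulOp (fun x => (W₂ k x)ᵀ) ∘ₗ G₂' k ∘ₗ mmulOp (W₂ k)) -
            ∑ k, (mmulOp (fun x => (W₂ k x)ᵀ) ∘ₗ E₂' k ∘ₗ mmulOp (W₂ k)) ∘ₗ mulOp (fun p : X × κ => hX k p.1)))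
      (fun y y' => ((Nov * (cs * ((Fintype.card κ : ℝ) ^ 2 * εD) + cd * ((Fintype.card κ : ℝ) ^ 2 * εG)) +
            Nov * (cs * ((Fintype.card κ : ℝ) ^ 2 * β₁) + cd * ((Fintype.card κ : ℝ) ^ 2 * β)) * ((1 - Nov * ((Fintype.card κ : ℝ) ^ 2 * θ₀ + (Fintype.card κ : ℝ) ^ 2 * ε) * cr)⁻¹ * cr) *
              (Nov * ((Fintype.card κ : ℝ) ^ 2 * εK + (Fintype.card κ : ℝ) ^ 2 * εE)) * cr) * ((1 - Nov * ((Fintype.card κ : ℝ) ^ 2 * θ₀ + (Fintype.card κ : ℝ) ^ 2 * ε) * cr)⁻¹ * cr) +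
          (Nov * (cs * (2 * ((Fintype.card κ : ℝ) ^ 2 * β₁)) + cd * (2 * ((Fintype.card κ : ℝ) ^ 2 * β))) +
            Nov * (cs * ((Fintype.card κ : ℝ) ^ 2 * β₁) + cd * ((Fintype.card κ : ℝ) ^ 2 * β)) * ((1 - Nov * ((Fintype.card κ : ℝ) ^ 2 * θ₀ + (Fintype.card κ : ℝ) ^ 2 * ε) * cr)⁻¹ * cr) *
              (Nov * (2 * ((Fintype.card κ : ℝ) ^ 2 * ε)) + Nov * (2 * ((Fintype.card κ : ℝ) ^ 2 * θ₀))) * cr) *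
            ((1 - Nov * ((Fintype.card κ : ℝ) ^ 2 * θ₀ + (Fintype.card κ : ℝ) ^ 2 * ε) * cr)⁻¹ * cr) * Real.exp (-((δ / 4 - σ) * dZ y))) *
        Real.exp (-((δ / 4 - 2 * σ) * g.dist y y'))) := by
  refine hasMaj_comp_glued_sub_of_cutRows_defect_close (liftBlk blk κ) S Far Z dZ htri hd hd0 hrow hσ hcr hdZ hdZ0 (by positivity) (by positivity) hcs hcd (by positivity)
    (by positivity) (by positivity) (by positivity) (by positivity) (by positivity) hNov hσδ hleib hleib₂ hcut hh hhs hdh hN hZ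
    (fun k => cutRow_of_localGauge blk S W χX G' hW hW' hβ k (hGc' k)) (fun k => cutRow_of_localGauge blk S W₂ χX G₂' hW₂ hW₂' hβ k (hGc₂' k))
    (fun k => dcutRow_of_localGauge blk S W V D Dl χX G' hW hV' hβ₁ k (hDcov k) (hDGc' k))
    (fun k => dcutRow_of_localGauge blk S W₂ V₂ D₂ Dl₂ χX G₂' hW₂ hV₂' hβ₁ k (hDcov₂ k) (hDGc₂' k))
    (fun k => commRow_of_localGauge blk S W Δ hX G' hW hW' hθ k (hK' k)) (fun k => commRow_of_localGauge blk S W₂ Δ₂ hX G₂' hW₂ hW₂' hθ k (hK₂' k))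
    (fun k => defectRow_of_localGauge blk S W E' hW hW' hε k (hE' k)) (fun k => defectRow_of_localGauge blk S W₂ E₂' hW₂ hW₂' hε k (hE₂' k))
    (fun k hk => ?_) (fun k hk => ?_) (fun k hk => ?_) (fun k hk => ?_) hq
  · rw [hWW k hk]; exact cutRow_sub_of_localGauge blk S W χX G' G₂' hW hW' hεG k (hGG k hk)
  · have hc₂ := hDcov₂ k
    rw [hWW k hk, hVV k hk] at hc₂
    rw [hWW k hk]
    exact dcutRow_sub_of_localGauge blk S W V D Dl χX G' D₂ Dl₂ G₂' hW hV' hεD k (hDcov k) hc₂ (hDGG k hk)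
  · rw [hWW k hk]; exact commRow_sub_of_localGauge blk S W Δ Δ₂ hX G' G₂' hW hW' hεK k (hKK k hk)
  · rw [hWW k hk]; exact defectRow_sub_of_localGauge blk S W E' E₂' hW hW' hεE k (hEE k hk)

end LocalGauges

end Summit.QuantumFields.YangMills.BalabanUVNodes.N15.CurvedSpecies

end
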